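import Summits.PneNP.PneNP.Theorems.ConvexRankGatesCliqueExtLowerBoundWidthThresholdDefs
import Summits.PneNP.PneNP.Theorems.ConvexRankGatesCliqueExtLowerBoundStubInline
import Summits.PneNP.PneNP.Theorems.ConvexRankGatesCliqueExtLowerBoundStubAndThresholdAssembly
import Summits.PneNP.PneNP.Theorems.ConvexRankGatesCliqueExtLowerBoundConvHellyReduction
import Literature.Computability.Complexity.MonotoneSwitchingLeafPairs

/-!
# Real-computable gates are sandwichable (line `width-threshold-certificate-sparsity`, reshape r6)

`realGate_of_realInline`: from REAL INLINE FREENESS (hypothesis, verbatim the conclusion of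
`realInline_of_engine`): a gate which, on inputs constant on the classes of ANY class map
`cls : Fin n → Fin n'`, is a threshold of a monotone real straight-line program over the `n'` classes
of length `≤ m^c (n'+1)` and fan-in `≤ ⌊m^{1/16}⌋₊`, fed with `≤ m^{c+3}` distinct local child pairs,
is `(r,s)`-sandwichable on the referee pair with error `1/(8m^{c+1})`.
Proof: merge equal child pairs (`AndThreshold.exists_classes` with key `j ↦ (D j, C j)`), take the
program for that class map (`n' ≤ m^{c+3}`, so length `≤ m^{2c+4}`), run real inline freeness with
`a = 2c+4` on the representatives' pairs, and transport the two error sets along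
`D j = D (rep (cls j))`, `C j = C (rep (cls j))`.
-/

set_option linter.dupNamespace false

open Literature.Computability.Complexity Filter Finset

namespace Summit.PneNP.PneNP.Theorems.CliqueExtLowerBound.WidthThreshold.RealGate

open Classical in
/-- **Registered stub `realGate_of_realInline`** (crux stmt-PneNP-10682, line `width-threshold-certificate-sparsity`,
reshape r6). [cite: Jukna2012, Thm. 9.21] -/
theorem realGate_of_realInline : (∀ a c : ℕ, ∃ r₀ s₀ : ℕ, 2 ≤ r₀ ∧ 2 ≤ s₀ ∧ ∀ r s : ℕ, r₀ ≤ r → s₀ ≤ s → ∀ᶠ m : ℕ in atTop, ∀ (n T K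
    : ℕ) (ev : (Fin n → Bool) → Fin T → ℝ), (∀ t : Fin T, ∃ (k : ℕ) (src : Fin k → Fin n ⊕ Fin T) (φ
    : (Fin k → ℝ) → ℝ), k ≤ K ∧ (∀ i t', src i = Sum.inr t' → t' < t) ∧ Monotone φ ∧ ∀ u : Fin n →
    Bool, ev u t = φ (fun i => Sum.elim (fun j => if u j then (1 : ℝ) else 0) (ev u) (src i))) → T ≤
    m ^ a → K ≤ ⌊(m : ℝ) ^ (1 / 16 : ℝ)⌋₊ → ∀ (t : Fin T) (θ : ℝ) (D C : Fin n → Finset (Finset ((⊤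
    : SimpleGraph (Fin m)).edgeSet))), (∀ j, ∀ R ∈ D j, #R ≤ r - 1) → (∀ j, ∀ S ∈ C j, #S ≤ s - 1) →
    (∀ j x, EvalDNF (D j) x → EvalCNF (C j) x) → ∃ dnf cnf : Finset (Finset ((⊤ : SimpleGraph (Fin
    m)).edgeSet)), (∀ R ∈ dnf, #R ≤ r - 1) ∧ (∀ S ∈ cnf, #S ≤ s - 1) ∧ (∀ x, EvalDNF dnf x → EvalCNF
    cnf x) ∧ (#((posGraphs m ⌈(m : ℝ) ^ (1 / 4 : ℝ)⌉₊).filter (fun x => θ ≤ ev (fun j => decide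
    (EvalDNF (D j) x)) t ∧ ¬ EvalDNF dnf x)) : ℝ) ≤ (1 / (8 * (m : ℝ) ^ (c + 1))) * #(posGraphs m
    ⌈(m : ℝ) ^ (1 / 4 : ℝ)⌉₊) ∧ (#((((powersetCard (Fintype.card ((⊤ : SimpleGraph (Fin m)).edgeSet)
    / ⌊(m : ℝ) ^ (1 / 8 : ℝ)⌋₊) (univ : Finset ((⊤ : SimpleGraph (Fin m)).edgeSet))).image (fun M =>
    fun e => decide (e ∉ M)))).filter (fun x => EvalCNF cnf x ∧ ¬ θ ≤ ev (fun j => decide (EvalCNF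
    (C j) x)) t)) : ℝ) ≤ (1 / (8 * (m : ℝ) ^ (c + 1))) * #(((powersetCard (Fintype.card ((⊤ :
    SimpleGraph (Fin m)).edgeSet) / ⌊(m : ℝ) ^ (1 / 8 : ℝ)⌋₊) (univ : Finset ((⊤ : SimpleGraph (Fin
    m)).edgeSet))).image (fun M => fun e => decide (e ∉ M))))) → ∀ c : ℕ, ∃ r₀ s₀ : ℕ, 2 ≤ r₀ ∧ 2 ≤
    s₀ ∧ ∀ r s : ℕ, r₀ ≤ r → s₀ ≤ s → ∀ᶠ m : ℕ in atTop, ∀ φ : GateFn, (∀ (n' : ℕ) (cls : Fin φ.1 →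
    Fin n'), ∃ (T K : ℕ) (ev : (Fin n' → Bool) → Fin T → ℝ) (t : Fin T) (θ : ℝ), T ≤ m ^ c * (n' +
    1) ∧ K ≤ ⌊(m : ℝ) ^ (1 / 16 : ℝ)⌋₊ ∧ (∀ w : Fin T, ∃ (k : ℕ) (src : Fin k → Fin n' ⊕ Fin T) (ψ :
    (Fin k → ℝ) → ℝ), k ≤ K ∧ (∀ i t', src i = Sum.inr t' → t' < w) ∧ Monotone ψ ∧ ∀ u : Fin n' →
    Bool, ev u w = ψ (fun i => Sum.elim (fun j => if u j then (1 : ℝ) else 0) (ev u) (src i))) ∧ ∀ u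
    : Fin n' → Bool, φ.2 (fun j => u (cls j)) = true ↔ θ ≤ ev u t) → ∀ (D C : Fin φ.1 → Finset
    (Finset ((⊤ : SimpleGraph (Fin m)).edgeSet))), #(univ.image fun j => (D j, C j)) ≤ m ^ (c + 3) →
    (∀ j, ∀ R ∈ D j, #R ≤ r - 1) → (∀ j, ∀ S ∈ C j, #S ≤ s - 1) → (∀ j x, EvalDNF (D j) x → EvalCNF
    (C j) x) → ∃ dnf cnf : Finset (Finset ((⊤ : SimpleGraph (Fin m)).edgeSet)), (∀ R ∈ dnf, #R ≤ r -
    1) ∧ (∀ S ∈ cnf, #S ≤ s - 1) ∧ (∀ x, EvalDNF dnf x → EvalCNF cnf x) ∧ (#((posGraphs m ⌈(m : ℝ) ^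
    (1 / 4 : ℝ)⌉₊).filter (fun x => φ.2 (fun j => decide (EvalDNF (D j) x)) = true ∧ ¬ EvalDNF dnf
    x)) : ℝ) ≤ (1 / (8 * (m : ℝ) ^ (c + 1))) * #(posGraphs m ⌈(m : ℝ) ^ (1 / 4 : ℝ)⌉₊) ∧
    (#((((powersetCard (Fintype.card ((⊤ : SimpleGraph (Fin m)).edgeSet) / ⌊(m : ℝ) ^ (1 / 8 : ℝ)⌋₊)
    (univ : Finset ((⊤ : SimpleGraph (Fin m)).edgeSet))).image (fun M => fun e => decide (e ∉
    M)))).filter (fun x => EvalCNF cnf x ∧ φ.2 (fun j => decide (EvalCNF (C j) x)) = false)) : ℝ) ≤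
    (1 / (8 * (m : ℝ) ^ (c + 1))) * #(((powersetCard (Fintype.card ((⊤ : SimpleGraph (Fin
    m)).edgeSet) / ⌊(m : ℝ) ^ (1 / 8 : ℝ)⌋₊) (univ : Finset ((⊤ : SimpleGraph (Fin
    m)).edgeSet))).image (fun M => fun e => decide (e ∉ M)))) := by
  intro hRI c
  obtain ⟨r₀, s₀, hr₀, hs₀, hev⟩ := hRI (2 * c + 4) c
  refine ⟨r₀, s₀, hr₀, hs₀, fun r s hr hs => ?_⟩
  filter_upwards [hev r s hr hs, eventually_ge_atTop 2] with m hm hm2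
  intro φ hCP D C hA hD hC hDC
  -- merge equal child pairs
  obtain ⟨cls, rep, hkey⟩ := AndThreshold.exists_classes (fun j => (D j, C j))
  obtain ⟨T, K, ev, t, θ, hT, hK, hloc, hiff⟩ := hCP _ cls
  -- the program is short: `T ≤ m^c (n'+1) ≤ m^c (m^{c+3}+1) ≤ m^{2c+4}`
  have hTm : T ≤ m ^ (2 * c + 4) := by
    have h1 : 1 ≤ m := by omega
    have hc3 : 1 ≤ m ^ (c + 3) := Nat.one_le_pow _ _ h1
    calc T ≤ m ^ c * (#(univ.image fun j => (D j, C j)) + 1) := hT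
      _ ≤ m ^ c * (m ^ (c + 3) + 1) := Nat.mul_le_mul_left _ (by omega)
      _ ≤ m ^ c * (m ^ (c + 3) * 2) := Nat.mul_le_mul_left _ (by omega)
      _ ≤ m ^ c * (m ^ (c + 3) * m) := Nat.mul_le_mul_left _ (Nat.mul_le_mul_left _ hm2)
      _ = m ^ (2 * c + 4) := by rw [← pow_succ, ← pow_add]; ring_nf
  -- real inline freeness on the representatives' pairs
  obtain ⟨dnf, cnf, hdnf, hcnf, hdc, hP, hN⟩ := hm _ T K ev hloc hTm hK t θ (fun κ => D (rep κ))
    (fun κ => C (rep κ)) (fun κ => hD _) (fun κ => hC _) (fun κ => hDC _)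
  have hDr : ∀ j, D (rep (cls j)) = D j := fun j => congrArg Prod.fst (hkey j)
  have hCr : ∀ j, C (rep (cls j)) = C j := fun j => congrArg Prod.snd (hkey j)
  refine ⟨dnf, cnf, hdnf, hcnf, hdc, ?_, ?_⟩
  · -- positives: the two error events coincide pointwise
    have h : ∀ x, (φ.2 (fun j => decide (EvalDNF (D j) x)) = true ∧ ¬ EvalDNF dnf x) ↔
        (θ ≤ ev (fun κ => decide (EvalDNF (D (rep κ)) x)) t ∧ ¬ EvalDNF dnf x) := fun x => by
      have hx : (fun j => decide (EvalDNF (D j) x)) =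
          fun j => decide (EvalDNF (D (rep (cls j))) x) := by
        funext j; simp only [hDr]
      rw [hx]
      exact (hiff fun κ => decide (EvalDNF (D (rep κ)) x)).and Iff.rfl
    rw [Finset.filter_congr fun x _ => h x]
    exact hP
  · -- negatives: `φ (…C…) = false ↔ ¬ θ ≤ ev u' t`
    have h : ∀ x, (EvalCNF cnf x ∧ φ.2 (fun j => decide (EvalCNF (C j) x)) = false) ↔
        (EvalCNF cnf x ∧ ¬ θ ≤ ev (fun κ => decide (EvalCNF (C (rep κ)) x)) t) := fun x => by
      have hx : (fun j => decide (EvalCNF (C j) x)) =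
          fun j => decide (EvalCNF (C (rep (cls j))) x) := by
        funext j; simp only [hCr]
      rw [hx]
      exact Iff.rfl.and
        (Bool.eq_false_iff.trans (hiff fun κ => decide (EvalCNF (C (rep κ)) x)).not)
    rw [Finset.filter_congr fun x _ => h x]
    exact hN

end Summit.PneNP.PneNP.Theorems.CliqueExtLowerBound.WidthThreshold.RealGate
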